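import Mathlib
import Literature.MathematicalPhysics.QuantumFieldTheory.Balaban1983to89.B12Ineq45

/-! # `Balaban1983to89.B12Ineq39` — the bound (3.9) of [I] §3 p. 271, kernel-derived from [15] Sect. G (190)

CITATION HEADER.  Surge node (cell pub-balaban, unit b2b-balaban-pv12 gen 2, journal claim G-IF-06-39-KERNEL): the
SECOND consumer in [I] of the decay estimate (190) of [15] named by GAPS G-IF-06 (the first, (4.5) p. 282, is the
sibling module `B12Ineq45`).  Source: T. Bałaban, *Renormalization group approach to lattice gauge field theories. I.
Generation of effective actions in a small field approximation and a coupling constant renormalization in four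
dimensions*, Commun. Math. Phys. 109 (1987) 249–301 [`Balaban1987RG1`], §3 p. 271 [PDF 23], render
`b2b-balaban-ref1/pages/1987-cmp109-rg-I-small-field/…-p023-x2.png`, read as an image.  VERBATIM (p. 271, the case
X ∩ (□̃²)ᶜ ≠ ∅ of (3.5)): *"There are two cases possible, either X∩□̃ = ∅, or X∩□̃ ≠ ∅. In the first case dist(X,□) ≥ M,
the distance is in the scale η, hence in the scale ξ dist^{(ξ)}(X,□) ≥ M(L^jη)^{−1}."* … *"The function 𝐇_j depends
on the configuration U_{k+1}. The expression on the right-hand side is differential with respect to t_□, at t_□ = 0,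
and this yields"* (3.7) … *"The derivative (δ/δB)𝐇_j is an exponentially decaying function, with the decay rate δ₀ on
the ξ-scale, see Proposition 9, (190) [15]. Let us denote
  δ𝐇_j = ⟨((δ/δB)𝐇_j)(B(t)), ⟨((δ/δ𝐀)Q_j)(ηt𝐇_k(B′)), L^jη ζ_□𝐇_k(B′)⟩⟩.   (3.8)
In the case when dist^{(ξ)}(X, □) ≥ M(L^jη)^{−1}, this function satisfies the bound
  |δ𝐇_j| ≤ B₃ exp(−½δ₀ dist^{(ξ)}(X, □) − ½δ₀M(L^jη)^{−1}) × 2L^jη|ζ_□𝐇_k(B′)|  on X,   (3.9)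
and the same for derivatives and the second order operators applied to it. Using the above bound, and the
analyticity properties of 𝐄^{(j)}, we can obtain easily the required bound for (3.7)."*  ([15] =
[`Balaban1985Variational`], Sect. G p. 308 (190), typed by the cell as the block majorant `B11SectG.Ineq190`.)

WHAT IS KERNEL-CHECKED HERE (value = kernel certificate of a located by-reference step, NOT summit progress).
(3.9) is (190) applied to the linear map δB ↦ ⟨((δ/δB)𝐇_j)(B(t)), δB⟩ at the field δB = ⟨((δ/δ𝐀)Q_j)(ηt𝐇_k(B′)),
L^jη ζ_□𝐇_k(B′)⟩ of (3.8), which is localised in the cube □ at ξ-distance ≥ dist^{(ξ)}(X, □) ≥ M(L^jη)^{−1} from X: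
* `exp_split_le` — the only arithmetic of the display: e^{−τD} ≤ e^{−½τ·dist − ½τ·M′} whenever dist ≤ D, M′ ≤ D, τ ≥ 0
  (used with D = dist = dist^{(ξ)}(X, □) and M′ = M(L^jη)^{−1} ≤ dist, the case hypothesis);
* `loc_dH_le_39` — in the block vocabulary of `B11SectG` ((190) = `Ineq190 bB bout dH C δ₀` =
  `HasMaj bB bout dH (C·e^{−⅛δ₀d(y,y′)})`, one row sum `RowSum g σ c` of Lemma 2.1 [3]): for a field δB whose block
  sizes are ≤ m everywhere and = 0 on every block y′ with d(y, y′) < dist for y ∈ X, and M′ ≤ dist,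
  loc_y(dH δB) ≤ C κ_B c · e^{−½τ·dist − ½τ·M′} · m for y ∈ X, for every rate τ ≥ 0 with σ + τ ≤ ⅛δ₀ — this is
  `B12Ineq45.loc_dH_le_of_ineq190_localised` (the (4.5) consumer's lemma) followed by `exp_split_le`;
* `Data39` / `Ineq39Printed` — the display (3.9) typed VERBATIM over named reals, and `ineq39_of_ineq190` — (3.9)
  holds with B₃^{(3.9)} = C·κ_B·c(σ) and δ₀^{(3.9)} = τ, for ANY τ ≥ 0 with σ + τ ≤ ⅛δ₀^{[15]} (so δ₀^{[I]} < ⅛δ₀^{[15]}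
  strictly: the constants-ledger relabelling of GAPS G-IF-06 made explicit a second time, cf. SMALLNESS S-B12.17),
  given the factor m = 2L^jη|ζ_□𝐇_k(B′)| as the bound of the block sizes of δB.
LEAVES (hypotheses, by name; none is minted as a fact): `h190` = (190) of [15] for dH = ((δ/δB)𝐇_j)(B(t)) (its
transport from the base point to B(t) inside the analyticity domain (170) is [15] Prop. 9 / GAPS G-B11-G2a);
`hrow` = Lemma 2.1 (2.61) [3]; `hm` = the block sizes of the field (3.8) are ≤ 2L^jη|ζ_□𝐇_k(B′)| (the factor of
(3.9) as printed — a bound of the derivative of the averaging Q_j, not displayed in [I]; DIVERGENCE row); `hD` = δB is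
localised in □ and dist^{(ξ)}(X, □) is the ξ-distance (geometry of (3.5)); `hcase` = the case hypothesis
dist^{(ξ)}(X, □) ≥ M(L^jη)^{−1}.  NOT HERE: "the same for derivatives and the second order operators" (the other
entries of (190): the same lemma with another `bout`), the bound for (3.7) ("easily", analyticity of 𝐄^{(j)} — the
mechanism of `B12Repr43`), the second case of (3.5).  Elementary; [folklore] where not a citation. -/

namespace Literature.MathematicalPhysics.QuantumFieldTheory.Balaban1983to89.B12Ineq39

open Literature.MathematicalPhysics.QuantumFieldTheory.Balaban1983to89
open B11SectG B12Ineq45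

/-! ## The arithmetic of the exponent in (3.9) -/

/-- e^{−τD} ≤ e^{−½τ·dist − ½τ·M′} for `dist ≤ D`, `M′ ≤ D`, `τ ≥ 0` — the split of the decay factor of (190) into
the two halves displayed in (3.9). [folklore] -/
theorem exp_split_le {τ D dist M' : ℝ} (hτ : 0 ≤ τ) (h1 : dist ≤ D) (h2 : M' ≤ D) :
    Real.exp (-(τ * D)) ≤ Real.exp (-(1 / 2 * τ * dist) - 1 / 2 * τ * M') := by
  refine Real.exp_le_exp.mpr ?_
  have h1' : τ * dist ≤ τ * D := mul_le_mul_of_nonneg_left h1 hτ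
  have h2' : τ * M' ≤ τ * D := mul_le_mul_of_nonneg_left h2 hτ
  linarith

/-! ## (3.9) from (190) in the block vocabulary of `B11SectG` -/

section FromB11

variable {g : B6.Geometry} {FB FA : Type} [AddCommGroup FB] [Module ℝ FB] [AddCommGroup FA] [Module ℝ FA]

/-- **(3.9) ⇐ (190)**, block form (kernel-checked): if dH = ((δ/δB)𝐇_j)(B(t)) has the majorant (190)
(`Ineq190 bB bout dH C δ₀`), the row sum (2.61) holds at rate `σ` with constant `c`, the field `δB` has block sizes
`≤ m` and vanishes on every block `y′` with `d(y, y′) < dist` for `y ∈ X` (δB localised in □, `dist` =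
dist^{(ξ)}(X, □)), and `M′ ≤ dist` (the case dist^{(ξ)}(X, □) ≥ M(L^jη)^{−1}), then for `y ∈ X`
`loc_y(dH δB) ≤ C κ_B c · e^{−½τ·dist − ½τ·M′} · m` for every `τ ≥ 0` with `σ + τ ≤ ⅛δ₀`.
[cite: Balaban1987RG1, (3.9) p.271; Balaban1985Variational, (190) p.308; Balaban1984PropagatorsII, Lemma 2.1 (2.61) p.234] -/
theorem loc_dH_le_39 {bB : BlockNorm g FB} {bout : BlockNorm g FA} {dH : FB →ₗ[ℝ] FA}
    {C δ₀ σ τ c m dist M' : ℝ} (h190 : Ineq190 bB bout dH C δ₀) (hC : 0 ≤ C)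
    (hd : ∀ a b : g.Site, 0 ≤ g.dist a b) (hrow : RowSum g σ c) (hτ : 0 ≤ τ) (hστ : σ + τ ≤ δ₀ / 8)
    (δB : FB) (hm : ∀ y', bB.loc y' δB ≤ m) (X : Set g.Site)
    (hD : ∀ y ∈ X, ∀ y', bB.loc y' δB ≠ 0 → dist ≤ g.dist y y') (hcase : M' ≤ dist) {y : g.Site} (hy : y ∈ X) :
    bout.loc y (dH δB) ≤ C * bB.κ * c * Real.exp (-(1 / 2 * τ * dist) - 1 / 2 * τ * M') * m := by
  have h1 := loc_dH_le_of_ineq190_localised h190 hC hd hrow hτ hστ δB hm X hD hy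
  have hm0 : 0 ≤ m := (bB.loc_nonneg y δB).trans (hm y)
  have hc0 : 0 ≤ c := le_trans (Finset.sum_nonneg fun y' _ => (Real.exp_nonneg _)) (hrow y)
  have hK : 0 ≤ C * bB.κ * c * m := mul_nonneg (mul_nonneg (mul_nonneg hC bB.κ_nonneg) hc0) hm0
  calc bout.loc y (dH δB) ≤ C * bB.κ * c * m * Real.exp (-(τ * dist)) := h1
    _ ≤ C * bB.κ * c * m * Real.exp (-(1 / 2 * τ * dist) - 1 / 2 * τ * M') :=
        mul_le_mul_of_nonneg_left (exp_split_le hτ le_rfl hcase) hK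
    _ = C * bB.κ * c * Real.exp (-(1 / 2 * τ * dist) - 1 / 2 * τ * M') * m := by ring

end FromB11

/-! ## The display (3.9) as printed, and its derivation -/

section Display

/-- The named reals of the display (3.9) p. 271 [PDF 23] at one block y ∈ X: `B₃`, `δ₀` (the constants AS USED IN
[I], cf. GAPS G-IF-06), `distX` = dist^{(ξ)}(X, □), `Minv` = M(L^jη)^{−1}, `Ljη` = L^jη, `normZH` = |ζ_□𝐇_k(B′)|,
`lhs` = |δ𝐇_j| (the local size of the function (3.8) at a point / block of X). [cite: Balaban1987RG1, (3.9) p.271] -/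
structure Data39 where
  /-- the constant B₃ of (3.9) -/
  B₃ : ℝ
  /-- the rate δ₀ of (3.9) (ξ-scale) -/
  δ₀ : ℝ
  /-- dist^{(ξ)}(X, □) -/
  distX : ℝ
  /-- M(L^jη)^{−1} -/
  Minv : ℝ
  /-- L^jη -/
  Ljη : ℝ
  /-- |ζ_□𝐇_k(B′)| -/
  normZH : ℝ
  /-- |δ𝐇_j| on X (at the block considered) -/
  lhs : ℝ

/-- **(3.9)** p. 271 [PDF 23], verbatim: *"In the case when dist^{(ξ)}(X, □) ≥ M(L^jη)^{−1}, this function satisfies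
the bound |δ𝐇_j| ≤ B₃ exp(−½δ₀ dist^{(ξ)}(X, □) − ½δ₀M(L^jη)^{−1}) × 2L^jη|ζ_□𝐇_k(B′)| on X"* — typed over the
named reals of `Data39`. [cite: Balaban1987RG1, (3.9) p.271] -/
def Ineq39Printed (D : Data39) : Prop :=
  D.lhs ≤ D.B₃ * Real.exp (-(1 / 2 * D.δ₀ * D.distX) - 1 / 2 * D.δ₀ * D.Minv) * (2 * D.Ljη * D.normZH)

variable {g : B6.Geometry} {FB FA : Type} [AddCommGroup FB] [Module ℝ FB] [AddCommGroup FA] [Module ℝ FA]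

/-- **(3.9) kernel-derived from (190)** (the by-reference step *"see Proposition 9, (190) [15]"* of p. 271): in the
block vocabulary, with dH = ((δ/δB)𝐇_j)(B(t)) obeying (190) (`h190`), one row sum (`hrow`), the field δB of (3.8)
having block sizes ≤ 2L^jη|ζ_□𝐇_k(B′)| (`hm`) and localised in □ (`hD`, `distX` = dist^{(ξ)}(X, □)), in the case
M(L^jη)^{−1} ≤ dist^{(ξ)}(X, □) (`hcase`), the display (3.9) holds at every block y ∈ X with the constants
B₃ = C·κ_B·c(σ) and δ₀^{(3.9)} = τ for any τ ≥ 0 with σ + τ ≤ ⅛δ₀^{[15]} (GAPS G-IF-06: the [I]-rate is strictly below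
the [15]-rate ⅛δ₀). [cite: Balaban1987RG1, (3.9) p.271; Balaban1985Variational, (190) p.308; Balaban1984PropagatorsII, Lemma 2.1 (2.61) p.234] -/
theorem ineq39_of_ineq190 (D : Data39) {bB : BlockNorm g FB} {bout : BlockNorm g FA} {dH : FB →ₗ[ℝ] FA}
    {C δ₀ σ c : ℝ} (h190 : Ineq190 bB bout dH C δ₀) (hC : 0 ≤ C) (hd : ∀ a b : g.Site, 0 ≤ g.dist a b)
    (hrow : RowSum g σ c) (hτ : 0 ≤ D.δ₀) (hστ : σ + D.δ₀ ≤ δ₀ / 8) (hB₃ : D.B₃ = C * bB.κ * c)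
    (δB : FB) (hm : ∀ y', bB.loc y' δB ≤ 2 * D.Ljη * D.normZH) (X : Set g.Site)
    (hD : ∀ y ∈ X, ∀ y', bB.loc y' δB ≠ 0 → D.distX ≤ g.dist y y') (hcase : D.Minv ≤ D.distX)
    {y : g.Site} (hy : y ∈ X) (hlhs : D.lhs = bout.loc y (dH δB)) : Ineq39Printed D := by
  unfold Ineq39Printed
  rw [hlhs, hB₃]
  exact loc_dH_le_39 h190 hC hd hrow hτ hστ δB hm X hD hcase hy

/-- Unfolding check: (3.9) with its exponent written as ONE decay factor at the average of the two lengths —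
e^{−½δ₀·dist − ½δ₀·M′} = e^{−δ₀·(dist + M′)/2} (kernel arithmetic). [folklore] -/
theorem ineq39_exp_eq (D : Data39) :
    Real.exp (-(1 / 2 * D.δ₀ * D.distX) - 1 / 2 * D.δ₀ * D.Minv)
      = Real.exp (-(D.δ₀ * ((D.distX + D.Minv) / 2))) := by
  congr 1; ring

end Display

end Literature.MathematicalPhysics.QuantumFieldTheory.Balaban1983to89.B12Ineq39
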